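import Summits.QuantumFields.GaugeBoot.BootstrapGaugeInvariantCuts
import Summits.QuantumFields.GaugeBoot.BootstrapLinkCutsAllAxes
import HarnessLib

/-!
# The link cuts on WILSON-LOOP data at negative coupling: the `SU(2n+1)` bootstrap with link-RP
# blocks of gauge-invariant test functions is infeasible at every `β < 0` (gauge-boot, L3 ↔ L1)

HONEST FRAMING (cell `pub-gaugeboot`, page 1 of every file): the venture produces certified bounds
on lattice expectations at stated coupling, gauge group, dimension and torus size; NOT a mass gap,
NOT a continuum limit, NOT a string tension; NOT Yang–Mills-summit-bearing (barriers
`FixedCouplingUltralocality`, `PerturbativeInvisibility`). Structural; it certifies no number; no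
certificate of the cell sits at `β < 0`.

## Content

`BootstrapLinkCutsAllAxes` showed that the link cuts along any axis of `(ℤ/2Q)^d` are inconsistent
with the `SU(2n+1)` torus bootstrap at every `β < 0` — for the PLAIN family (all closed-half test
functions). A Kazakov–Zheng bootstrap imposes the cuts on WILSON-LOOP data only (gauge-invariant test
functions; `giRpCutLevelValuesSuN` of `BootstrapGaugeInvariantCuts`). The cell's negative witness —
the baryon star of the layer `x_k = 1` times the positive-half Boltzmann factor, `netWitness` — IS
gauge invariant, so the failure persists on Wilson-loop data:

* `holonomy_cubicUnit_gaugeTransform`, `plaqObs_cubicUnit_gaugeTransform`,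
  `posAction_cubicUnit_gaugeTransform` — on the cubic torus the frame theory's plaquette observables
  and positive-half action are gauge invariant (plaquette holonomies transform by conjugation);
  `netObs_gaugeTransform` — a layer network with a gauge-invariant value function is a
  gauge-invariant observable (`det ρ ≡ 1`); ★ `isGaugeInvariant_netWitness_cubicUnit`;
* ★★ `exists_gi_linkRP_witness_suN_odd` — `(ℤ/2Q)^d`, `Q ≥ 2`, `SU(N)` with `N` odd, `3 ≤ N`,
  `N + 3 ≤ 2d`, any axis `k`, every `β < 0`: a GAUGE-INVARIANT bounded measurable observable of the
  closed half `{1 ≤ x_k ≤ Q}` with negative reflection pairing; ★★ `not_giLinkRP_suN_odd`,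
  ★★★ `giLinkRP_suN_odd_iff` — link RP ON GAUGE-INVARIANT OBSERVABLES holds iff `0 ≤ β`;
* ★★★ `giLinkCuts_sound_iff_suOdd` — the link cuts on Wilson-loop data keep the Wilson value feasible
  at every level for every observable IFF `0 ≤ β`; ★★★ `giLinkCutLevelValues_eventually_eq_empty_suOdd`
  — at every `β < 0` the Wilson-loop SDP with link-RP blocks is INFEASIBLE at all large levels;
  ★★★ `exists_giLinkCut_neg_of_bootstrap_suOdd` — every solution violates a Wilson-loop link cut;
  `SU(3)`, `d ≥ 3`: `giLinkCuts_sound_iff_su3`, `giLinkCutLevelValues_eventually_eq_empty_su3`.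

References: V. Kazakov, Z. Zheng, arXiv:2203.11360 §3.1, §4; M. Creutz, Quarks, Gluons and Lattices
(1983) Ch. 8 (baryon diagrams); K. Osterwalder, E. Seiler, Ann. Phys. 110 (1978) 440 §2. Folklore.
-/

noncomputable section

open MeasureTheory Filter Topology NormedSpace
open scoped ComplexOrder ComplexConjugate
open Literature.MathematicalPhysics.QuantumFieldTheory (LatticeRep Site Edge GaugeConfig gaugeTransform
  IsGaugeInvariant wilsonAction wilsonMeasure isProbabilityMeasure_wilsonMeasure)

namespace Summit.QuantumFields.GaugeBoot

open Literature.MathematicalPhysics.QuantumLattice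
open TiltedRP (cubicUnit cubicAxisReflect cubicAxisCoord configMidReflect IsMidObservable isSiteFrame_cubicTorus
  netWitness posAction plaqObs holonomy)
open LayerNet (netObs)
open Baryon (starLink starVal)

/-! ## Gauge invariance of the frame theory's observables on the cubic torus -/

section GaugeInvariance

variable {d L N : ℕ} {G : Type*} [Group G] (ρ : G →* Matrix (Fin N) (Fin N) ℂ)

omit ρ in
/-- **Plaquette holonomies of the cubic torus transform by conjugation** (frame theory's `holonomy` at
`e = cubicUnit`; tree `gaugeTransform`). [folklore] -/
theorem holonomy_cubicUnit_gaugeTransform (g : Site d L → G) (U : GaugeConfig d L G) (x : Site d L)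
    (k l : Fin d) :
    holonomy (cubicUnit d L) (gaugeTransform g U) x k l = g x * holonomy (cubicUnit d L) U x k l * (g x)⁻¹ := by
  have hc : x + Pi.single k (1 : ZMod L) + Pi.single l 1 = x + Pi.single l 1 + Pi.single k 1 :=
    add_right_comm _ _ _
  simp only [TiltedRP.holonomy, gaugeTransform, Site.shift, TiltedRP.cubicUnit, hc, mul_inv_rev, inv_inv]
  group

/-- **The plaquette observables of the cubic torus are gauge invariant.** [folklore] -/
theorem plaqObs_cubicUnit_gaugeTransform (g : Site d L → G) (U : GaugeConfig d L G) (p : TiltedRP.Plaq (Site d L) d) :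
    plaqObs ρ (cubicUnit d L) p (gaugeTransform g U) = plaqObs ρ (cubicUnit d L) p U := by
  unfold TiltedRP.plaqObs
  rw [holonomy_cubicUnit_gaugeTransform, map_mul, map_mul, Matrix.trace_mul_cycle, ← map_mul,
    inv_mul_cancel, map_one, one_mul]

/-- **The positive-half action of the cubic frame is gauge invariant.** [folklore] -/
theorem posAction_cubicUnit_gaugeTransform {Q : ℕ} [NeZero Q] (k : Fin d) (g : Site d (2 * Q) → G)
    (U : GaugeConfig d (2 * Q) G) :
    posAction ρ (cubicUnit d (2 * Q)) k Q (cubicAxisCoord d (2 * Q) k) (gaugeTransform g U) =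
      posAction ρ (cubicUnit d (2 * Q)) k Q (cubicAxisCoord d (2 * Q) k) U := by
  unfold TiltedRP.posAction
  exact Finset.sum_congr rfl fun p _ => plaqObs_cubicUnit_gaugeTransform ρ g U p

/-- **A layer network with a gauge-invariant value function is a gauge-invariant observable** of the
cubic torus (`det ρ ≡ 1`; frame theory's `LayerNet.IsGaugeInvariant` at `e = cubicUnit`; the tree's
`gaugeTransform`). [folklore] -/
theorem netObs_gaugeTransform {J : Type*} (t : J → Edge d L) {Ω : (J → G) → ℂ}
    (hΩ : LayerNet.IsGaugeInvariant ρ (cubicUnit d L) t Ω) (hdet : ∀ g : G, (ρ g).det = 1)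
    (g : Site d L → G) (U : GaugeConfig d L G) :
    netObs t Ω (gaugeTransform g U) = netObs t Ω U :=
  hΩ g (fun j => U (t j)) fun z => hdet (g z)

/-- ★ **The cell's link-RP witness is gauge invariant** (`(ℤ/2Q)^d`, axis `k`; `netWitness` of a
layer network `t` with a gauge-invariant value function `Ω`, `det ρ ≡ 1`). [folklore] -/
theorem isGaugeInvariant_netWitness_cubicUnit {Q : ℕ} [NeZero Q] {J : Type*} [Fintype J] (k : Fin d) (β : ℝ)
    (t : J → Edge d (2 * Q)) {Ω : (J → G) → ℂ}
    (hΩ : LayerNet.IsGaugeInvariant ρ (cubicUnit d (2 * Q)) t Ω) (hdet : ∀ g : G, (ρ g).det = 1) :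
    IsGaugeInvariant (netWitness ρ (cubicUnit d (2 * Q)) k Q (cubicAxisCoord d (2 * Q) k) β t Ω) := by
  intro g U
  unfold TiltedRP.netWitness
  rw [netObs_gaugeTransform ρ t hΩ hdet, posAction_cubicUnit_gaugeTransform]

end GaugeInvariance

/-! ## A gauge-invariant witness: link RP fails on Wilson-loop data at `β < 0` for `SU(2n+1)` -/

section Witness

variable {d Q N : ℕ} [NeZero Q]

/-- ★★ **`SU(N)`, `N` odd, `3 ≤ N`, `N + 3 ≤ 2d`, `(ℤ/2Q)^d`, `Q ≥ 2`, any axis `k`, every `β < 0`: a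
GAUGE-INVARIANT bounded measurable observable `F` of the closed half `{1 ≤ x_k ≤ Q}` with
`∫ conj F(Θ_k U) · F(U) dμ_β < 0`** — the baryon star of the layer `x_k = 1` times `exp(-β A)`
(`cubicTorus_linkRP_suN_neg_of_odd` with its witness made explicit). [folklore] -/
theorem exists_gi_linkRP_witness_suN_odd (hQ : 2 ≤ Q) (k : Fin d) (hN : Odd N) (h3 : 3 ≤ N)
    (hNd : N + 3 ≤ 2 * d) {β : ℝ} (hβ : β < 0) :
    ∃ F : GaugeConfig d (2 * Q) (Matrix.specialUnitaryGroup (Fin N) ℂ) → ℂ, Measurable F ∧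
      (∃ C : ℝ, ∀ U, ‖F U‖ ≤ C) ∧ IsMidObservable (cubicUnit d (2 * Q)) Q (cubicAxisCoord d (2 * Q) k) F ∧
      IsGaugeInvariant F ∧
      ∫ U, conj (F (configMidReflect (cubicUnit d (2 * Q)) k (cubicAxisReflect d (2 * Q) k) U)) *
        F U ∂(wilsonMeasure (d := d) (L := 2 * Q) (fundamentalRep (Fin N)) β) < 0 := by
  haveI : SecondCountableTopology (Matrix (Fin N) (Fin N) ℂ) :=
    inferInstanceAs (SecondCountableTopology (Fin N → Fin N → ℂ))
  haveI : SecondCountableTopology (Matrix.specialUnitaryGroup (Fin N) ℂ) :=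
    Topology.IsEmbedding.subtypeVal.secondCountableTopology
  have h2 := Nat.odd_iff.1 hN
  obtain ⟨l, μ, hl, hμk, hμl, hμ⟩ := TiltedRP.exists_star_axes (n := N / 2) k (by omega)
  obtain ⟨φ⟩ := TiltedRP.nonempty_equiv_starLegs hN
  set ρ : Matrix.specialUnitaryGroup (Fin N) ℂ →* Matrix (Fin N) (Fin N) ℂ := fundamentalRep (Fin N) with hρdef
  have hρ : Continuous ρ := continuous_fundamentalRep (Fin N)
  have hdet : ∀ g : Matrix.specialUnitaryGroup (Fin N) ℂ, (ρ g).det = 1 := fun g =>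
    (Matrix.mem_specialUnitaryGroup_iff.1 g.2).2
  have hF := isSiteFrame_cubicTorus d hQ k
  have hx₁ := TiltedRP.val_cubicAxisCoord_cubicUnit hQ k
  have hΩc := Baryon.continuous_starVal ρ hρ φ
  refine ⟨netWitness ρ (cubicUnit d (2 * Q)) k Q (cubicAxisCoord d (2 * Q) k) β
      (starLink (cubicUnit d (2 * Q)) (cubicUnit d (2 * Q) k) l μ) (starVal ρ φ),
    (TiltedRP.continuous_netWitness ρ (cubicUnit d (2 * Q)) k Q (cubicAxisCoord d (2 * Q) k) hρ β _ hΩc).measurable,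
    TiltedRP.exists_norm_netWitness_le ρ (cubicUnit d (2 * Q)) k Q (cubicAxisCoord d (2 * Q) k) hρ β _ hΩc,
    hF.isMidObservable_netWitness ρ (hF.val_height_starLink hx₁ hl hμk) (Baryon.starLink_snd_ne _ _ hl hμk) _ β,
    isGaugeInvariant_netWitness_cubicUnit ρ k β _ (Baryon.isGaugeInvariant_starVal ρ _ _ l μ φ) hdet, ?_⟩
  rw [← TiltedRP.gibbs_cubicUnit_eq_wilsonMeasure ρ hρ β]
  exact hF.linkRP_star_neg_of_neg ρ hρ TiltedRP.hasScalarCommutant_fundamentalRep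
    (TiltedRP.exists_fundamentalRep_ne_one (by omega)) hdet hx₁ hl hμk φ
    (TiltedRP.starLink_injective_cubicTorus hQ _ hμ hμl) hβ

/-- ★★ **Link RP on GAUGE-INVARIANT observables fails at every `β < 0`** (`SU(N)`, `N` odd, `3 ≤ N`,
`N + 3 ≤ 2d`; `(ℤ/2Q)^d`, `Q ≥ 2`; any axis). [folklore] -/
theorem not_giLinkRP_suN_odd (hQ : 2 ≤ Q) (k : Fin d) (hN : Odd N) (h3 : 3 ≤ N) (hNd : N + 3 ≤ 2 * d)
    {β : ℝ} (hβ : β < 0) :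
    ¬ GIReflectionPositiveOn (wilsonMeasure (d := d) (L := 2 * Q) (fundamentalRep (Fin N)) β)
      (midReflectCM k) (midHalfLinks Q k) := by
  intro h
  obtain ⟨F, hFm, hFb, hFo, hFG, hneg⟩ := exists_gi_linkRP_witness_suN_odd hQ k hN h3 hNd hβ
  exact absurd (h F hFm hFb hFG ((isMidObservable_iff_dependsOn Q k F).1 hFo)) (not_le_of_gt hneg)

/-- ★★★ **Link RP on gauge-invariant observables holds IFF `0 ≤ β`** (`SU(N)`, `N` odd, `3 ≤ N`,
`N + 3 ≤ 2d`; `(ℤ/2Q)^d`, `Q ≥ 2`; any axis). [folklore] -/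
theorem giLinkRP_suN_odd_iff (hQ : 2 ≤ Q) (k : Fin d) (hN : Odd N) (h3 : 3 ≤ N) (hNd : N + 3 ≤ 2 * d)
    (β : ℝ) :
    GIReflectionPositiveOn (wilsonMeasure (d := d) (L := 2 * Q) (fundamentalRep (Fin N)) β)
        (midReflectCM k) (midHalfLinks Q k) ↔ 0 ≤ β := by
  refine ⟨fun h => ?_, fun hβ => ((reflectionPositiveOn_midReflect_iff (fundamentalRep (Fin N)) β k).2
    (TiltedRP.cubicTorus_linkRP_suN hQ k hβ)).gi⟩
  by_contra hβ
  exact not_giLinkRP_suN_odd hQ k hN h3 hNd (not_le.1 hβ) h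

end Witness

/-! ## The link cuts on Wilson-loop data -/

section Unitary

variable {d Q : ℕ} [NeZero Q] {N : ℕ} (β : ℝ)

/-- ★★★ **THE LINK CUTS ON WILSON-LOOP DATA ARE CONSISTENT WITH THE `SU(N)` TORUS BOOTSTRAP IFF
`β ≥ 0`** (`N` odd, `3 ≤ N`, `N + 3 ≤ 2d`; `(ℤ/2Q)^d`, `Q ≥ 2`; any axis `k`): the Wilson value of
every observable is feasible with the gauge-invariant link cuts at every level iff `0 ≤ β`. [folklore] -/
theorem giLinkCuts_sound_iff_suOdd (hQ : 2 ≤ Q) (k : Fin d) (hN : Odd N) (h3 : 3 ≤ N) (hNd : N + 3 ≤ 2 * d) :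
    (∀ (n : ℕ) (P : C(GaugeConfig d (2 * Q) (Matrix.specialUnitaryGroup (Fin N) ℂ), ℝ)),
        ∫ U, P U ∂(wilsonMeasure (fundamentalRep (Fin N)) β) ∈
          giRpCutLevelValuesSuN N β (midReflectCM k) (midHalfLinks Q k) n P) ↔ 0 ≤ β := by
  rw [← giLinkRP_suN_odd_iff hQ k hN h3 hNd β]
  exact (giRpCuts_sound_iff_suN
    (measurePreserving_midReflectCM_wilson (fundamentalRep (Fin N)) (continuous_fundamentalRep _) hQ k β)
    (midReflectCM_midReflectCM hQ k) (fun _ hg => comp_midReflectCM_mem_polyAlgebra _ k hg)).symm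

/-- ★★★ **At every `β < 0` the Wilson-loop SDP with link-RP blocks is INFEASIBLE at all large levels,
for every objective** (`N` odd, `3 ≤ N`, `N + 3 ≤ 2d`; `(ℤ/2Q)^d`, `Q ≥ 2`; any axis). [folklore] -/
theorem giLinkCutLevelValues_eventually_eq_empty_suOdd (hQ : 2 ≤ Q) (k : Fin d) (hN : Odd N) (h3 : 3 ≤ N)
    (hNd : N + 3 ≤ 2 * d) (hβ : β < 0)
    (P : C(GaugeConfig d (2 * Q) (Matrix.specialUnitaryGroup (Fin N) ℂ), ℝ)) :
    ∀ᶠ n in atTop, giRpCutLevelValuesSuN N β (midReflectCM k) (midHalfLinks Q k) n P = ∅ :=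
  giRpCutLevelValues_eventually_eq_empty_suN
    (measurePreserving_midReflectCM_wilson (fundamentalRep (Fin N)) (continuous_fundamentalRep _) hQ k β)
    (midReflectCM_midReflectCM hQ k) (fun _ hg => comp_midReflectCM_mem_polyAlgebra _ k hg)
    (not_giLinkRP_suN_odd hQ k hN h3 hNd hβ) P

/-- ★★★ **At every `β < 0` EVERY solution of the untruncated `SU(N)` torus bootstrap violates a
Wilson-loop link cut**: a GAUGE-INVARIANT polynomial observable `f` of the closed half
`{1 ≤ x_k ≤ Q}` with `φ ((f ∘ Θ_k) · f) < 0`. [folklore] -/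
theorem exists_giLinkCut_neg_of_bootstrap_suOdd (hQ : 2 ≤ Q) (k : Fin d) (hN : Odd N) (h3 : 3 ≤ N)
    (hNd : N + 3 ≤ 2 * d) (hβ : β < 0)
    {φ : C(GaugeConfig d (2 * Q) (Matrix.specialUnitaryGroup (Fin N) ℂ), ℝ) →ₗ[ℝ] ℝ} (h1 : φ 1 = 1)
    (hpos : ∀ a ∈ polyAlgebra (ι := Edge d (2 * Q)) (fundamentalLatticeRep N), 0 ≤ φ (a * a))
    (hφ : IsSDFunctional (fundamentalLatticeRep N) (suExp N) (fun _ => wilsonAction (fundamentalRep (Fin N))) β φ) :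
    ∃ f ∈ polyAlgebra (ι := Edge d (2 * Q)) (fundamentalLatticeRep N), IsGaugeInvariant (⇑f) ∧
      IsMidObservable (cubicUnit d (2 * Q)) Q (cubicAxisCoord d (2 * Q) k) (⇑f) ∧
        φ (f.comp (midReflectCM k) * f) < 0 := by
  obtain ⟨f, hf, hfG, hfS, hneg⟩ := exists_giRpCut_neg_of_bootstrap_suN
    (measurePreserving_midReflectCM_wilson (fundamentalRep (Fin N)) (continuous_fundamentalRep _) hQ k β)
    (midReflectCM_midReflectCM hQ k) (fun _ hg => comp_midReflectCM_mem_polyAlgebra _ k hg)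
    (not_giLinkRP_suN_odd hQ k hN h3 hNd hβ) h1 hpos hφ
  exact ⟨f, hf, hfG, (isMidObservable_iff_dependsOn Q k _).2 hfS, hneg⟩

/-- ★★★ **`SU(3)`, `d ≥ 3`: the link cuts on Wilson-loop data are consistent IFF `0 ≤ β`.** [folklore] -/
theorem giLinkCuts_sound_iff_su3 (hQ : 2 ≤ Q) (k : Fin d) (hd : 3 ≤ d) :
    (∀ (n : ℕ) (P : C(GaugeConfig d (2 * Q) (Matrix.specialUnitaryGroup (Fin 3) ℂ), ℝ)),
        ∫ U, P U ∂(wilsonMeasure (fundamentalRep (Fin 3)) β) ∈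
          giRpCutLevelValuesSuN 3 β (midReflectCM k) (midHalfLinks Q k) n P) ↔ 0 ≤ β :=
  giLinkCuts_sound_iff_suOdd β hQ k (by decide) le_rfl (by omega)

/-- ★★★ **`SU(3)`, `d ≥ 3`, every `β < 0`: the Wilson-loop SDP with link-RP blocks is eventually
infeasible for every objective.** [folklore] -/
theorem giLinkCutLevelValues_eventually_eq_empty_su3 (hQ : 2 ≤ Q) (k : Fin d) (hd : 3 ≤ d) (hβ : β < 0)
    (P : C(GaugeConfig d (2 * Q) (Matrix.specialUnitaryGroup (Fin 3) ℂ), ℝ)) :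
    ∀ᶠ n in atTop, giRpCutLevelValuesSuN 3 β (midReflectCM k) (midHalfLinks Q k) n P = ∅ :=
  giLinkCutLevelValues_eventually_eq_empty_suOdd β hQ k (by decide) le_rfl (by omega) hβ P

end Unitary

end Summit.QuantumFields.GaugeBoot

end
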